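import Summits.RiemannHypothesis.RiemannHypothesis.Theorems.TiltedLandingLaw421R3Lens1MeridianLocal

/-!
# IMAGE «Lens1MeridianOrd» v1 (lens-1 g12) — the pole-vertical graph at a zero of ANY ORDER

On top of #180 «Lens1MeridianLocal» (its real-variable lemmas `graph_of_halfSlope`, `halfSlope_row`, `end_signs`, `im_lower`, `im_upper` are reused):
(L1m) `PoleVerticalGraphOrd` + `poleVerticalGraph_ord` = (L1)'s conclusion VERBATIM at a zero `T` of `f^{(j)}` of any order `m ≥ 1` (hypothesis
`f^{(j+1)} T ≠ 0` replaced by `∃ w, f^{(j)} w ≠ 0`), via `pole_expansion_ord`: `φ = m/(z − T) + Ψ` (`AnalyticAt.analyticOrderAt_eq_natCast` + the identity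
theorem).  Needed by the lift (G) of #172's (B1) at the OTHER zeros of `f^{(j)}` in `T`'s half-disc, which need not be simple.
(B1)/(B2), stub 1′ and ⟨27010⟩ stay OPEN; RH is not proved; nothing here asserts an open law.
-/

namespace RhW08.Lens1MeridianOrd

open Complex Set Metric Literature.Analysis.Complex RhW08.Lens1ArcSign RhW08.Lens1MeridianLocal

/-- (L1m) POLE-VERTICAL GRAPH at a zero of any order: (L1) v2's conclusion VERBATIM, hypothesis `f^{(j+1)} T ≠ 0` replaced by
`∃ w, f^{(j)} w ≠ 0`. -/
def PoleVerticalGraphOrd : Prop :=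
  ∀ (f : ℂ → ℂ) (j : ℕ) (T : ℂ), Differentiable ℂ f → iteratedDeriv j f T = 0 → 0 < T.im → (∃ w, iteratedDeriv j f w ≠ 0) →
    ∃ r : ℝ, 0 < r ∧ ∃ X : ℝ → ℝ, ContinuousOn X (Icc (T.im - r) T.im) ∧ X T.im = T.re ∧
      (∀ y : ℝ, T.im - r ≤ y → y < T.im →
        |X y - T.re| ≤ r ∧ |X y - T.re| ≤ (T.im - y) / 4 ∧ (phiAt f j ⟨X y, y⟩).re = 0 ∧
        1 / (4 * (T.im - y)) ≤ (phiAt f j ⟨X y, y⟩).im ∧ ∀ x : ℝ, |x - T.re| ≤ r → (phiAt f j ⟨x, y⟩).re = 0 → x = X y) ∧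
      (∀ x y : ℝ, |x - T.re| ≤ r → T.im ≤ y → y ≤ T.im + r → (⟨x, y⟩ : ℂ) ≠ T → (phiAt f j ⟨x, y⟩).re = 0 →
        (phiAt f j ⟨x, y⟩).im < 0)

/-- (L1a-m) POLE EXPANSION at a zero of order `m ≥ 1`: `φ = m/(z − T) + Ψ` on a punctured ball, `Ψ` continuous, bounded, Lipschitz. -/
theorem pole_expansion_ord (f : ℂ → ℂ) (j : ℕ) (T : ℂ) (hf : Differentiable ℂ f) (hT : iteratedDeriv j f T = 0)
    (hne : ∃ w, iteratedDeriv j f w ≠ 0) :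
    ∃ m : ℕ, 1 ≤ m ∧ ∃ r M : ℝ, 0 < r ∧ 0 ≤ M ∧ ∃ Ψ : ℂ → ℂ, ContinuousOn Ψ (ball T r) ∧ (∀ z ∈ ball T r, ‖Ψ z‖ ≤ M) ∧
      (∀ z₁ ∈ ball T r, ∀ z₂ ∈ ball T r, ‖Ψ z₁ - Ψ z₂‖ ≤ M * ‖z₁ - z₂‖) ∧
      ∀ z ∈ ball T r, z ≠ T → iteratedDeriv j f z ≠ 0 ∧ phiAt f j z = (m : ℂ) / (z - T) + Ψ z := by
  set G := iteratedDeriv j f with hG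
  have hGd : Differentiable ℂ G := differentiable_iteratedDeriv_of_entire hf j
  have hGa : AnalyticAt ℂ G T := hGd.analyticAt T
  have hfin : analyticOrderAt G T ≠ ⊤ := by
    intro htop
    obtain ⟨w, hw⟩ := hne
    have hev := analyticOrderAt_eq_top.mp htop
    have hz : Set.EqOn G 0 Set.univ :=
      AnalyticOnNhd.eqOn_zero_of_preconnected_of_eventuallyEq_zero (fun z _ => hGd.analyticAt z) isPreconnected_univ
        (Set.mem_univ T) hev
    exact hw (hz (Set.mem_univ w))
  obtain ⟨m, hm⟩ := ENat.ne_top_iff_exists.mp hfin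
  have hm0 : m ≠ 0 := by
    intro h0; rw [h0] at hm
    exact (hGa.analyticOrderAt_ne_zero.mpr hT) (by exact_mod_cast hm.symm)
  obtain ⟨k, rfl⟩ := Nat.exists_eq_succ_of_ne_zero hm0
  obtain ⟨H, hHa, hHT, hfacE⟩ := (hGa.analyticOrderAt_eq_natCast).mp hm.symm
  obtain ⟨r₄, hr₄, hfac⟩ := Metric.eventually_nhds_iff_ball.mp hfacE
  set Ψ : ℂ → ℂ := fun z => deriv H z / H z with hΨ
  have hΨa : AnalyticAt ℂ Ψ T := hHa.deriv.div hHa hHT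
  obtain ⟨r₁, hr₁, hH₁⟩ := hHa.exists_ball_analyticOnNhd
  obtain ⟨r₂, hr₂, hΨ₂⟩ := hΨa.exists_ball_analyticOnNhd
  obtain ⟨r₃, hr₃, hH₃⟩ := Metric.eventually_nhds_iff_ball.mp (hHa.continuousAt.eventually_ne hHT)
  set r₀ := min (min r₁ r₂) (min r₃ r₄) with hr₀def
  have hr₀ : 0 < r₀ := lt_min (lt_min hr₁ hr₂) (lt_min hr₃ hr₄)
  have hΨon : AnalyticOnNhd ℂ Ψ (ball T r₀) :=
    hΨ₂.mono (Metric.ball_subset_ball (le_trans (min_le_left _ _) (min_le_right _ _)))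
  have hcl : closedBall T (r₀ / 2) ⊆ ball T r₀ := Metric.closedBall_subset_ball (by linarith)
  obtain ⟨M₁, hM₁⟩ := (isCompact_closedBall T (r₀ / 2)).exists_bound_of_continuousOn (hΨon.continuousOn.mono hcl)
  obtain ⟨M₂, hM₂⟩ := (isCompact_closedBall T (r₀ / 2)).exists_bound_of_continuousOn (hΨon.deriv.continuousOn.mono hcl)
  refine ⟨k + 1, Nat.succ_pos k, r₀ / 2, max (max M₁ M₂) 0, by linarith, le_max_right _ _, Ψ,
    hΨon.continuousOn.mono (Metric.ball_subset_closedBall.trans hcl), ?_, ?_, ?_⟩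
  · intro z hz
    exact (hM₁ z (Metric.ball_subset_closedBall hz)).trans ((le_max_left _ _).trans (le_max_left _ _))
  · intro z₁ hz₁ z₂ hz₂
    exact Convex.norm_image_sub_le_of_norm_deriv_le (f := Ψ) (s := ball T (r₀ / 2))
      (fun x hx => (hΨon x (hcl (Metric.ball_subset_closedBall hx))).differentiableAt)
      (fun x hx => (hM₂ x (Metric.ball_subset_closedBall hx)).trans ((le_max_right _ _).trans (le_max_left _ _)))
      (convex_ball T (r₀ / 2)) hz₂ hz₁
  · intro z hz hzT
    have hz₀ : z ∈ ball T r₀ := hcl (Metric.ball_subset_closedBall hz)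
    have hHz : H z ≠ 0 := hH₃ z (Metric.ball_subset_ball ((min_le_right _ _).trans (min_le_left _ _)) hz₀)
    have hzT' : z - T ≠ 0 := sub_ne_zero.mpr hzT
    have hz₄ : z ∈ ball T r₄ := Metric.ball_subset_ball ((min_le_right _ _).trans (min_le_right _ _)) hz₀
    have hGz : G z = (z - T) ^ (k + 1) * H z := by rw [hfac z hz₄, smul_eq_mul]
    refine ⟨by rw [hGz]; exact mul_ne_zero (pow_ne_zero _ hzT') hHz, ?_⟩
    have hHd : DifferentiableAt ℂ H z :=
      (hH₁ z (Metric.ball_subset_ball ((min_le_left _ _).trans (min_le_left _ _)) hz₀)).differentiableAt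
    have hEq : G =ᶠ[nhds z] fun w => (w - T) ^ (k + 1) * H w := by
      filter_upwards [Metric.isOpen_ball.mem_nhds hz₄] with w hw
      rw [hfac w hw, smul_eq_mul]
    have hdG : deriv G z = ((k : ℂ) + 1) * (z - T) ^ k * H z + (z - T) ^ (k + 1) * deriv H z := by
      rw [hEq.deriv_eq]
      have h1 : HasDerivAt (fun w : ℂ => (w - T) ^ (k + 1)) (((k + 1 : ℕ) : ℂ) * (z - T) ^ (k + 1 - 1) * 1) z :=
        ((hasDerivAt_id z).sub_const T).pow (k + 1)
      have h2 : HasDerivAt (fun w : ℂ => (w - T) ^ (k + 1) * H w)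
          ((((k + 1 : ℕ) : ℂ) * (z - T) ^ (k + 1 - 1) * 1) * H z + (z - T) ^ (k + 1) * deriv H z) z := h1.mul hHd.hasDerivAt
      rw [h2.deriv]; push_cast; simp only [mul_one]
    show deriv G z / G z = ((k + 1 : ℕ) : ℂ) / (z - T) + deriv H z / H z
    rw [hdG, hGz]; push_cast
    field_simp
    ring

/-- real/imaginary parts of `φ = c/(z−T) + Ψ` (`c` real) cleared of the denominator `|z − T|²`. -/
theorem re_im_of_pole_ord {z T Ψz φz : ℂ} {c : ℝ} (hzT : z ≠ T) (h : φz = (c : ℂ) / (z - T) + Ψz) :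
    φz.re * normSq (z - T) = c * (z - T).re + normSq (z - T) * Ψz.re ∧
      φz.im * normSq (z - T) = -(c * (z - T).im) + normSq (z - T) * Ψz.im := by
  have hn : normSq (z - T) ≠ 0 := by rw [Ne, Complex.normSq_eq_zero]; exact sub_ne_zero.mpr hzT
  rw [h, Complex.add_re, Complex.add_im, div_eq_mul_inv, Complex.mul_re, Complex.mul_im, Complex.inv_re, Complex.inv_im,
    Complex.ofReal_re, Complex.ofReal_im]
  constructor <;> field_simp <;> ring

/-- on the graph of `c (x − a) + |z−T|² Re Ψ = 0` (`c ≥ 1`) the horizontal offset is quadratic in the height. -/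
theorem graph_offset_ord {a ρ M x d R c : ℝ} (hc : 1 ≤ c) (hρM : ρ * M ≤ 1 / 8) (hx : |x - a| ≤ ρ) (hR : |R| ≤ M)
    (h0 : c * (x - a) + ((x - a) ^ 2 + d ^ 2) * R = 0) : |x - a| ≤ 2 * d ^ 2 * M := by
  have hρ0 : 0 ≤ ρ := (abs_nonneg _).trans hx
  have hM : 0 ≤ M := (abs_nonneg R).trans hR
  have e : ((x - a) ^ 2 + d ^ 2) * R = -(c * (x - a)) := by linarith
  have h1 : c * |x - a| = ((x - a) ^ 2 + d ^ 2) * |R| := by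
    calc c * |x - a| = |c * (x - a)| := by rw [abs_mul, abs_of_pos (show (0 : ℝ) < c by linarith)]
      _ = |-(((x - a) ^ 2 + d ^ 2) * R)| := by rw [e, neg_neg]
      _ = ((x - a) ^ 2 + d ^ 2) * |R| := by rw [abs_neg, abs_mul, abs_of_nonneg (by positivity)]
  have h2 : (x - a) ^ 2 ≤ ρ * |x - a| := by rw [← sq_abs]; nlinarith [abs_nonneg (x - a)]
  have h3 : c * |x - a| ≤ (ρ * |x - a| + d ^ 2) * M :=
    calc c * |x - a| = ((x - a) ^ 2 + d ^ 2) * |R| := h1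
      _ ≤ (ρ * |x - a| + d ^ 2) * M :=
        mul_le_mul (by linarith) hR (abs_nonneg _) (add_nonneg (mul_nonneg hρ0 (abs_nonneg _)) (sq_nonneg d))
  have h4 : ρ * M * |x - a| ≤ 1 / 8 * |x - a| := mul_le_mul_of_nonneg_right hρM (abs_nonneg _)
  have h5 : |x - a| ≤ c * |x - a| := le_mul_of_one_le_left (abs_nonneg _) hc
  nlinarith [abs_nonneg (x - a), mul_nonneg (sq_nonneg d) hM, h3, h4]

/-- (L1m) PROVED. -/
theorem poleVerticalGraph_ord : PoleVerticalGraphOrd := by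
  intro f j T hf hT hq hne
  obtain ⟨m, hm1, r, M, hr, hM, Ψ, hΨc, hΨb, hΨL, hφ⟩ := pole_expansion_ord f j T hf hT hne
  set c : ℝ := (m : ℝ) with hcdef
  have hc1 : (1 : ℝ) ≤ c := by rw [hcdef]; exact_mod_cast hm1
  set ρ : ℝ := min (r / 4) (1 / (8 * (M + 1))) with hρdef
  have hρ : 0 < ρ := lt_min (by linarith) (by positivity)
  have hρr : ρ ≤ r / 4 := min_le_left _ _
  have hρM1 : ρ * (M + 1) ≤ 1 / 8 := by
    calc ρ * (M + 1) ≤ 1 / (8 * (M + 1)) * (M + 1) := mul_le_mul_of_nonneg_right (min_le_right _ _) (by positivity)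
      _ = 1 / 8 := by field_simp
  have hρM : ρ * M ≤ 1 / 8 := by nlinarith
  have hρ1 : ρ ≤ 1 := by nlinarith
  -- the box `|x − Re T| ≤ ρ, |y − Im T| ≤ ρ` lies in the ball
  have hball : ∀ x y : ℝ, |x - T.re| ≤ ρ → |y - T.im| ≤ ρ → (⟨x, y⟩ : ℂ) ∈ ball T r := by
    intro x y hx hy
    rw [mem_ball, dist_eq_norm]
    calc ‖(⟨x, y⟩ : ℂ) - T‖ ≤ |((⟨x, y⟩ : ℂ) - T).re| + |((⟨x, y⟩ : ℂ) - T).im| := Complex.norm_le_abs_re_add_abs_im _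
      _ = |x - T.re| + |y - T.im| := by simp
      _ < r := by linarith
  have hnormSq : ∀ x y : ℝ, normSq ((⟨x, y⟩ : ℂ) - T) = (x - T.re) ^ 2 + (y - T.im) ^ 2 := by
    intro x y; rw [Complex.normSq_apply]; simp; ring
  have hRe : ∀ x y : ℝ, |x - T.re| ≤ ρ → |y - T.im| ≤ ρ → |(Ψ ⟨x, y⟩).re| ≤ M := fun x y hx hy =>
    (Complex.abs_re_le_norm _).trans (hΨb _ (hball x y hx hy))
  have hIm : ∀ x y : ℝ, |x - T.re| ≤ ρ → |y - T.im| ≤ ρ → |(Ψ ⟨x, y⟩).im| ≤ M := fun x y hx hy =>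
    (Complex.abs_im_le_norm _).trans (hΨb _ (hball x y hx hy))
  -- key identities on the punctured box
  have hkey : ∀ x y : ℝ, |x - T.re| ≤ ρ → |y - T.im| ≤ ρ → (⟨x, y⟩ : ℂ) ≠ T →
      (phiAt f j ⟨x, y⟩).re * ((x - T.re) ^ 2 + (y - T.im) ^ 2) =
        c * (x - T.re) + ((x - T.re) ^ 2 + (y - T.im) ^ 2) * (Ψ ⟨x, y⟩).re ∧
      (phiAt f j ⟨x, y⟩).im * ((x - T.re) ^ 2 + (y - T.im) ^ 2) =
        c * (T.im - y) + ((x - T.re) ^ 2 + (y - T.im) ^ 2) * (Ψ ⟨x, y⟩).im := by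
    intro x y hx hy hzT
    obtain ⟨-, hφz⟩ := hφ _ (hball x y hx hy) hzT
    have hcast : ((m : ℕ) : ℂ) = ((c : ℝ) : ℂ) := by rw [hcdef]; norm_cast
    rw [hcast] at hφz
    have h := re_im_of_pole_ord hzT hφz
    rw [hnormSq] at h
    refine ⟨?_, ?_⟩
    · rw [h.1]; simp
    · rw [h.2]; simp; ring
  have hnpos : ∀ x y : ℝ, (⟨x, y⟩ : ℂ) ≠ T → 0 < (x - T.re) ^ 2 + (y - T.im) ^ 2 := by
    intro x y hzT; rw [← hnormSq]; exact Complex.normSq_pos.mpr (sub_ne_zero.mpr hzT)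
  -- continuity of F on the box
  have hmk : Continuous fun p : ℝ × ℝ => (⟨p.1, p.2⟩ : ℂ) := by
    have e : (fun p : ℝ × ℝ => (⟨p.1, p.2⟩ : ℂ)) = fun p => (p.1 : ℂ) + (p.2 : ℂ) * I := by
      funext p; exact Complex.mk_eq_add_mul_I p.1 p.2
    rw [e]
    exact (Complex.continuous_ofReal.comp continuous_fst).add ((Complex.continuous_ofReal.comp continuous_snd).mul continuous_const)
  have hFc : ContinuousOn (fun p : ℝ × ℝ => c * (p.1 - T.re) + ((p.1 - T.re) ^ 2 + (p.2 - T.im) ^ 2) * (Ψ ⟨p.1, p.2⟩).re)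
      {p : ℝ × ℝ | |p.1 - T.re| ≤ ρ ∧ |p.2 - T.im| ≤ ρ} := by
    have hΨp : ContinuousOn (fun p : ℝ × ℝ => Ψ ⟨p.1, p.2⟩) {p : ℝ × ℝ | |p.1 - T.re| ≤ ρ ∧ |p.2 - T.im| ≤ ρ} :=
      hΨc.comp hmk.continuousOn (fun p hp => hball p.1 p.2 hp.1 hp.2)
    exact ((continuous_const.mul (continuous_fst.sub continuous_const)).continuousOn).add
      ((((continuous_fst.sub continuous_const).pow 2).add ((continuous_snd.sub continuous_const).pow 2)).continuousOn.mul
        (Complex.continuous_re.comp_continuousOn hΨp))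
  have habsIcc : ∀ {c t : ℝ}, t ∈ Icc (c - ρ) (c + ρ) → |t - c| ≤ ρ := fun {c t} ht => by
    rw [abs_le]; constructor <;> linarith [ht.1, ht.2]
  have hIccabs : ∀ {c t : ℝ}, |t - c| ≤ ρ → t ∈ Icc (c - ρ) (c + ρ) := fun {c t} ht => by
    constructor <;> linarith [(abs_le.mp ht).1, (abs_le.mp ht).2]
  -- the graph
  obtain ⟨X, hXc, hX⟩ := graph_of_halfSlope
    (F := fun x y => c * (x - T.re) + ((x - T.re) ^ 2 + (y - T.im) ^ 2) * (Ψ ⟨x, y⟩).re) (a := T.re) (q := T.im) hρ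
    (by
      intro y hy x₁ x₂ hx₁ hx₂ hx
      have hd : |(Ψ ⟨x₂, y⟩).re - (Ψ ⟨x₁, y⟩).re| ≤ M * (x₂ - x₁) := by
        have e : (⟨x₂, y⟩ : ℂ) - ⟨x₁, y⟩ = ((x₂ - x₁ : ℝ) : ℂ) := by apply Complex.ext <;> simp
        calc |(Ψ ⟨x₂, y⟩).re - (Ψ ⟨x₁, y⟩).re| = |(Ψ ⟨x₂, y⟩ - Ψ ⟨x₁, y⟩).re| := by rw [Complex.sub_re]
          _ ≤ ‖Ψ ⟨x₂, y⟩ - Ψ ⟨x₁, y⟩‖ := Complex.abs_re_le_norm _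
          _ ≤ M * ‖(⟨x₂, y⟩ : ℂ) - ⟨x₁, y⟩‖ := hΨL _ (hball x₂ y hx₂ hy) _ (hball x₁ y hx₁ hy)
          _ = M * (x₂ - x₁) := by rw [e, Complex.norm_real, Real.norm_eq_abs, abs_of_nonneg (sub_nonneg.mpr hx)]
      have h := halfSlope_row hρ1 hM hρM hx₁ hx₂ hy hx (hRe x₂ y hx₂ hy) hd
      nlinarith [h, mul_nonneg (sub_nonneg.mpr hc1) (sub_nonneg.mpr hx)])
    (by
      intro y hy
      have h := (end_signs (R := (Ψ ⟨T.re - ρ, y⟩).re) hρ hρM hy (hRe _ y (by rw [sub_sub_cancel_left, abs_neg, abs_of_pos hρ]) hy)).2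
      have hcρ : ρ ≤ c * ρ := le_mul_of_one_le_left hρ.le hc1
      simp only [sub_sub_cancel_left]; linarith)
    (by
      intro y hy
      have h := (end_signs (R := (Ψ ⟨T.re + ρ, y⟩).re) hρ hρM hy (hRe _ y (by rw [add_sub_cancel_left, abs_of_pos hρ]) hy)).1
      have hcρ : ρ ≤ c * ρ := le_mul_of_one_le_left hρ.le hc1
      simp only [add_sub_cancel_left]; linarith)
    (by
      intro y hy
      have hl : Continuous fun x : ℝ => (x, y) := continuous_id.prodMk continuous_const
      exact hFc.comp hl.continuousOn (fun x hx => ⟨habsIcc hx, hy⟩))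
    (by
      intro x y hx hy
      have hl : Continuous fun y' : ℝ => (x, y') := continuous_const.prodMk continuous_id
      exact (hFc.comp hl.continuousOn (fun y' hy' => ⟨hx, habsIcc hy'⟩)).continuousWithinAt (hIccabs hy))
  refine ⟨ρ, hρ, X, hXc.mono (Icc_subset_Icc le_rfl (by linarith)), ?_, ?_, ?_⟩
  · -- X (Im T) = Re T
    have h0 : |T.im - T.im| ≤ ρ := by rw [sub_self, abs_zero]; exact hρ.le
    have h1 : |T.re - T.re| ≤ ρ := by rw [sub_self, abs_zero]; exact hρ.le
    exact ((hX T.im h0).2.2 T.re h1 (by simp)).symm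
  · -- rows below the pole
    intro y hy₁ hy₂
    have hy : |y - T.im| ≤ ρ := by rw [abs_le]; constructor <;> linarith
    obtain ⟨hXρ, hF0, huq⟩ := hX y hy
    have hzT : (⟨X y, y⟩ : ℂ) ≠ T := fun h => by have := congrArg Complex.im h; simp at this; linarith
    have hn := hnpos (X y) y hzT
    obtain ⟨kre, kim⟩ := hkey (X y) y hXρ hy hzT
    have hd : 0 < T.im - y := by linarith
    have hdM : (T.im - y) * M ≤ 1 / 8 := (mul_le_mul_of_nonneg_right (by linarith [(abs_le.mp hy).1]) hM).trans hρM
    have e2 : (y - T.im) ^ 2 = (T.im - y) ^ 2 := by ring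
    have hoff : |X y - T.re| ≤ 2 * (T.im - y) ^ 2 * M :=
      graph_offset_ord hc1 hρM hXρ (hRe (X y) y hXρ hy) (by rw [← e2]; exact hF0)
    refine ⟨hXρ, hoff.trans (by nlinarith [hdM, hd]), ?_, ?_, ?_⟩
    · have := kre; rw [hF0] at this
      rcases mul_eq_zero.mp this with h | h; exact h; exact absurd h hn.ne'
    · have him : (phiAt f j ⟨X y, y⟩).im =
          (c * (T.im - y) + ((X y - T.re) ^ 2 + (T.im - y) ^ 2) * (Ψ ⟨X y, y⟩).im) / ((X y - T.re) ^ 2 + (T.im - y) ^ 2) := by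
        rw [eq_div_iff (by rw [← e2]; exact hn.ne'), ← e2]; exact kim
      rw [him]
      have hn' : 0 < (X y - T.re) ^ 2 + (T.im - y) ^ 2 := by rw [← e2]; exact hn
      refine (im_lower hd hdM hoff (abs_le.mp (hIm (X y) y hXρ hy)).1).trans (div_le_div_of_nonneg_right ?_ hn'.le)
      nlinarith [mul_nonneg (sub_nonneg.mpr hc1) hd.le]
    · intro x hx hre
      have hzT' : (⟨x, y⟩ : ℂ) ≠ T := fun h => by have := congrArg Complex.im h; simp at this; linarith
      obtain ⟨kre', -⟩ := hkey x y hx hy hzT'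
      rw [hre, zero_mul] at kre'
      exact huq x hx kre'.symm
  · -- the closed upper half-box carries no point of the level set with `Im φ ≥ 0`
    intro x y hx hy₁ hy₂ hzT hre
    have hy : |y - T.im| ≤ ρ := by rw [abs_le]; constructor <;> linarith
    have hn := hnpos x y hzT
    obtain ⟨kre, kim⟩ := hkey x y hx hy hzT
    rw [hre, zero_mul] at kre
    have hoff : |x - T.re| ≤ 2 * (y - T.im) ^ 2 * M := graph_offset_ord hc1 hρM hx (hRe x y hx hy) kre.symm
    rcases eq_or_lt_of_le hy₁ with heq | hlt
    · exfalso
      apply hzT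
      have hx0 : x = T.re := by
        have : |x - T.re| ≤ 0 := by rw [← heq, sub_self] at hoff; simpa using hoff
        linarith [abs_nonneg (x - T.re), abs_eq_zero.mp (le_antisymm this (abs_nonneg _))]
      apply Complex.ext <;> simp [hx0, heq]
    · have hd : 0 < y - T.im := by linarith
      have hdM : (y - T.im) * M ≤ 1 / 8 := (mul_le_mul_of_nonneg_right (by linarith [(abs_le.mp hy).2]) hM).trans hρM
      have him : (phiAt f j ⟨x, y⟩).im =
          (c * (T.im - y) + ((x - T.re) ^ 2 + (y - T.im) ^ 2) * (Ψ ⟨x, y⟩).im) / ((x - T.re) ^ 2 + (y - T.im) ^ 2) := by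
        rw [eq_div_iff hn.ne']; exact kim
      rw [him]
      refine lt_of_le_of_lt (div_le_div_of_nonneg_right ?_ hn.le) (im_upper hd hdM hoff (abs_le.mp (hIm x y hx hy)).2)
      nlinarith [mul_nonneg (sub_nonneg.mpr hc1) hd.le]

end RhW08.Lens1MeridianOrd
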